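import Summits.QuantumFields.BalabanUV.Beta.GAN24.TwoLevelDefectVanishing
import Summits.QuantumFields.BalabanUV.Beta.GAN24.RespStepEffectiveEL
import Summits.QuantumFields.BalabanUV.Beta.GAN24.WardResidualFieldTotals
import Summits.QuantumFields.BalabanUV.Beta.GAN24.ContactCellRefine
import Summits.QuantumFields.BalabanUV.Beta.GAN24.BornLambdaVertexTent
import Summits.QuantumFields.BalabanUV.Beta.GAN24.TransverseDictionary

/-!
# `BalabanUV.Beta.GAN24.LambdaSlotWeightsTwoLevel` — binder row G-an2-4 ∕ (CONV-C), the (S) row ∕ (W-γ) one level up: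
# **THE Λ-SLOT WEIGHTS OF A FIELD RESPONSE ARE THE NEXT-LEVEL VALUE-HESSIAN IMAGE OF ITS SOURCE — `Σ'_u Σ_κ (H_j h)(κ,u)·lamCoeffK (KInvStep Lc j) (E2 j) Lc μ y κ u`
# `= −((Lc^j)^{d+2})⁻¹·(stepScale_j)⁻¹·Σ'_t Σ_l wΦ_{Lc^{j+1}} l μ (t − y)·h l t` (every `j`, every bounded `h`, in-block root) — AND THE Λ-SECTOR OF THE TWO-LEVEL PAIRING,
# SLOT SUM OUTSIDE, VANISHES FOR PERIODIC DATA**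
# (G-an2-4 CRUX TEAM (2), seat `b2b-balaban-gan24-formalise-leaf-06` = the (γ) hand, gen 49, FILE (ε-Λ))

NOT IN PRINT; OUR BOOKKEEPING ([folklore] BY NAME: road-S3∕p1's tent `RespStepEffectiveEL.lamCoeffK_KInvStep_E2_eq_neg_contourSumAdj` (the step Lagrange coefficient is
`−((Lc^j)^{d+2})⁻¹·𝒬ᵀ_{Lc}` of a translated column of `wΦ_{Lc^{j+1}}`), leaf-06 g46 `RelInvWardPairing.tsum_mul_contourSumAdj_bdd` (adjointness of `𝒬ᵀ`), an3∕leaf-06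
`WardResidualFieldTotals.constraintRow_colH_comb` + leaf-02 `ContactLambdaCommutator.tsum_sum_mul_linKerAt` + `CombFreeGaugeLegCharges.linAvgAt_eq_contourSum_of_comb_zero` (the
averaging constraint of a response column: `𝒬_{Lc}(colH G_j Lc l t) κ Y = 𝟙[(κ,Y) = (l,t)]·stepScale_j⁻¹`), TODAY's (δ2b) `TwoLevelDefectVanishing.constraintHessianSector_twoLevel_eq_zero`;
0 `def`, 0 cited fact, 0 `def … : Prop`, 0 sorry).
HONEST FRAMING (cell contract, verbatim): «discharging `BetaPertH` makes Bałaban's UV stability UNCONDITIONAL — a real constructive-QFT result; it is NOT the continuum limit and NOT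
the Clay problem.»  HONEST DEPENDENCY (verbatim): «continuum YM on T⁴ ⇐ BetaPertH ∧ nine spine estimates (0/9 proved); BetaPertH ⇐ (D1) ∧ (D4) ∧ CAP+tail; G-an2-4 gates asym,
D1 and NE2/3/4.»

WHY.  B″ (`GaugeReadSourcePairingSucc`) writes road-P2's `X_{j+1}(n, ψ; e)` as `−Σ'_{(κ,u)} (H_j h)(κ,u)·S_j κ u[R_n, R_ψ]`, `S_j = SrecAt j`, `h = colH G_{j+1}(e)`; the Λ-sector of
`S_j` (`WardLocusRecursive.SrecAt`, member `j ≥ 1`) is `(cΛ·wΛ_j)•SLam Lc (lamCoeffK (KInvStep Lc j) (E2 j) Lc) (hessFFAt ρ Lc)`, `SLam … κ u = −Σ_μ Σ'_y lamCoeffK … μ y κ u • hessFFAt ρ Lc μ y`.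
So the Λ-sector of `X_{j+1}` weights an1's constraint-Hessian table at the slot `(μ, y)` by `Σ'_{(κ,u)} (H_j h)(κ,u)·lamCoeffK … μ y κ u` — §2 computes this weight in closed
form: it is `−((Lc^j)^{d+2})⁻¹·stepScale_j⁻¹·(C_j h)(μ,y)` with `C_j h (μ,y) = Σ'_t Σ_l wΦ_{Lc^{j+1}} μ l (y − t)·h l t` — (β)'s «coarse weights `−lamCoeff(H h) = C h`» AT EVERY LEVEL
(ENGINE E30∕E31: the Λ-law `Λ = (2n^{2D})⁻¹·(C2′)`).  §3: hence the slot sum `Σ'_y Σ_μ T(μ,y)·(that weight)`, `T(μ,y)` = the table against `(H_j n, d(1_{B(y₀)}∘blk))` in (β)'s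
letters, is `const·Σ'_y Σ_μ (C_j h)·T = 0` by (δ2b) §3 for `Lc` odd, centred root, bounded `Lc`-periodic `n` — THE Λ-SECTOR OF THE TWO-LEVEL PAIRING VANISHES (slot sum OUTSIDE the
leg sums; moving it inside the legs to reach the literal `SLam` contraction is a Fubini step left to the assembly file).
* §1 `contourSum_colH_eq_ite` (the averaging constraint of a response column), `contourSum_fieldResponse` (`𝒬_{Lc}(H_j h) = stepScale_j⁻¹·h` for bounded `h`),
  `abs_fieldResponse_le` (uniform bound of `H_j h`).
* §2 **`tsum_fieldResponse_mul_lamCoeffK`** — the Λ-slot weights in closed form.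
* §3 **`lambdaSlotSum_twoLevel_eq_zero`** — the Λ-sector of the two-level pairing, slot sum outside, vanishes.
Asserts NO value of any resolvent column beyond the averaging constraint; the W and border sectors, the e3OfK unfolding and the pin assembly (⇒ `hX`) are NOT here; NOTHING of
(W-γ) at levels ≥ 1 ∕ (INV) ∕ (S) discharged; NEVER «G-an2-4 closed» as (CONV-C); NOT D1, NOT `BetaPertH`, NOT continuum, NOT Clay.  2026-08-23; no existing file touched.
-/

noncomputable section

open Finset
open scoped BigOperators
open Literature.MathematicalPhysics.QuantumFieldTheory
open Literature.MathematicalPhysics.QuantumFieldTheory.Balaban1983to89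
open Literature.MathematicalPhysics.QuantumFieldTheory.Balaban1983to89.Beta
open B12Sec2to5 (l1 l1_nonneg)
open ExpKernelCalculus (Site MKer Decays Zl summable_exp_shift' tsum_exp_shift')
open AffineAveraging (Form1 box toSite unitVec unitVec_apply dz contourSum)
open AffineReproduction (contourSumAdj)
open AveragingContours (blk)
open AveragingContoursRooted (ctrOff ctrOff_mem_box linAvgAt)
open AveragingHessianKernelsRooted (hessFFAt linKerAt)
open LatticeForm (quo)
open KernelSpecInstance (wΦ)
open OneStepKernelFamily (KInvStep colH)
open BalabanStepJetsSucc (E2 lamCoeffK)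
open Summit.QuantumFields.BalabanUV.Beta.AxialDressingRooted (IsCombBondAt coDressKBmAt decays_coDressKBmAt_KInvStep one_le_of_neZero)
open Summit.QuantumFields.BalabanUV.Beta.BorderedHessian (stepScale stepScale_ne_zero)
open Summit.QuantumFields.BalabanUV.Beta.GAN24.RelInvWardPairing (tsum_mul_contourSumAdj_bdd)
open Summit.QuantumFields.BalabanUV.Beta.GAN24.RespStepEffectiveEL (lamCoeffK_KInvStep_E2_eq_neg_contourSumAdj)
open Summit.QuantumFields.BalabanUV.Beta.GAN24.WardResidualFieldTotals (constraintRow_colH_comb)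
open Summit.QuantumFields.BalabanUV.Beta.E3CoDressedContact (summable_colH_mul_linKerAt)
open Summit.QuantumFields.BalabanUV.Beta.GAN24.ContactLambdaCommutator (tsum_sum_mul_linKerAt)
open Summit.QuantumFields.BalabanUV.Beta.GAN24.CombFreeGaugeLegCharges (linAvgAt_eq_contourSum_of_comb_zero)
open Summit.QuantumFields.BalabanUV.Beta.GAN24.BorderGaugeLegBlockPotential (colH_coDressKBmAt_eq_zero_of_isCombBond)
open Summit.QuantumFields.BalabanUV.Beta.GAN24.ContactCellRefine (summable_comp_quo')
open Summit.QuantumFields.BalabanUV.Beta.GAN24.BornLambdaVertexTent (summable_wΦ_shift)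
open Summit.QuantumFields.BalabanUV.Beta.GAN24.TransverseDictionary (wΦ_symm)
open Summit.QuantumFields.BalabanUV.Beta.GAN24.PeriodicDataFaceSums (summable_abs_source_colH)
open Summit.QuantumFields.BalabanUV.Beta.GAN24.TwoLevelDefectVanishing (abs_tsum_colH_source_le constraintHessianSector_twoLevel_eq_zero)

namespace Summit.QuantumFields.BalabanUV.Beta.GAN24.LambdaSlotWeightsTwoLevel

variable {d : ℕ} {Lc : ℕ} [NeZero Lc]

/-! ## §1 The averaging constraint of the response columns -/

/-- [folklore] **THE AVERAGING CONSTRAINT OF A RESPONSE COLUMN** (in-block root `ρ = toSite r`, every `j`): `𝒬_{Lc}(colH G_j Lc l t) κ Y = 𝟙[Y = t ∧ κ = l]·stepScale_j⁻¹`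
(the column is comb-free, so its straight contour sum is its rooted linear average = `Lc^{d+1}` × its `q¹`-pairing, and the constraint rows give the Kronecker). -/
theorem contourSum_colH_eq_ite {r : Fin (d + 1) → ℕ} (hr : r ∈ box (d + 1) Lc) (j : ℕ) (l : Fin (d + 1)) (t : Site (d + 1)) (κ : Fin (d + 1)) (Y : Site (d + 1)) :
    contourSum Lc (colH (coDressKBmAt (toSite r) Lc (KInvStep (d := d) Lc j)) Lc l t) κ Y = if Y = t ∧ κ = l then (stepScale d Lc j)⁻¹ else 0 := by
  classical
  have hLc1 : 1 ≤ Lc := one_le_of_neZero Lc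
  have hcomb : ∀ κ' u, IsCombBondAt (toSite r) Lc κ' u → colH (coDressKBmAt (toSite r) Lc (KInvStep (d := d) Lc j)) Lc l t κ' u = 0 :=
    fun κ' u hc => colH_coDressKBmAt_eq_zero_of_isCombBond (toSite r) (KInvStep (d := d) Lc j) l t hc
  rw [← linAvgAt_eq_contourSum_of_comb_zero hLc1 hr hcomb κ Y]
  have hK : ∃ δ C : ℝ, 0 < δ ∧ 0 ≤ C ∧ Decays (coDressKBmAt (toSite r) Lc (KInvStep (d := d) Lc j)) C δ :=
    decays_coDressKBmAt_KInvStep (d := d) hr j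
  have h1 := tsum_sum_mul_linKerAt hr (colH (coDressKBmAt (toSite r) Lc (KInvStep (d := d) Lc j)) Lc l t) κ Y
  have hswap : ∑' x, ∑ α, colH (coDressKBmAt (toSite r) Lc (KInvStep (d := d) Lc j)) Lc l t α x * linKerAt (toSite r) Lc κ Y (α, x)
      = ∑ α, ∑' x, colH (coDressKBmAt (toSite r) Lc (KInvStep (d := d) Lc j)) Lc l t α x * linKerAt (toSite r) Lc κ Y (α, x) :=
    Summable.tsum_finsetSum fun α _ => summable_colH_mul_linKerAt hK hLc1 hr l t α κ Y
  have h2 := constraintRow_colH_comb (d := d) hLc1 hr j κ l Y t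
  rw [← hswap, h1] at h2
  -- `(Lc^{d+1})⁻¹ · linAvgAt = 𝟙·(stepScale·Lc^{d+1})⁻¹`
  have hL : ((Lc : ℝ) ^ (d + 1)) ≠ 0 := pow_ne_zero _ (by exact_mod_cast NeZero.ne Lc)
  have e : linAvgAt (toSite r) (colH (coDressKBmAt (toSite r) Lc (KInvStep (d := d) Lc j)) Lc l t) Lc κ Y
      = (Lc : ℝ) ^ (d + 1) * (if Y = t ∧ κ = l then (stepScale d Lc j * (Lc : ℝ) ^ (d + 1))⁻¹ else 0) := by
    rw [← h2, ← mul_assoc, mul_inv_cancel₀ hL, one_mul]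
  rw [e]
  split_ifs
  · rw [mul_inv, ← mul_assoc, mul_comm ((Lc : ℝ) ^ (d + 1)), mul_assoc, mul_inv_cancel₀ hL, mul_one]
  · rw [mul_zero]

/-- [folklore] **UNIFORM BOUND OF A FIELD RESPONSE** (centred root): for `|h| ≤ B`, `|Σ_l Σ'_t h l t·colH G_j Lc l t κ u| ≤ (d+1)·B·C_H` with (δ2b)'s column constant. -/
theorem abs_fieldResponse_le (j : ℕ) :
    ∃ CR : ℝ, 0 ≤ CR ∧ ∀ {h : Form1 (d + 1) ℝ} {Bh : ℝ}, (∀ l t, |h l t| ≤ Bh) → ∀ (κ : Fin (d + 1)) (u : Site (d + 1)),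
      |∑ l, ∑' t : Site (d + 1), h l t * colH (coDressKBmAt (toSite (ctrOff (d + 1) Lc)) Lc (KInvStep (d := d) Lc j)) Lc l t κ u| ≤ ((d : ℝ) + 1) * Bh * CR := by
  obtain ⟨CH, hCH0, hCH⟩ := abs_tsum_colH_source_le (d := d) (Lc := Lc) j
  refine ⟨CH, hCH0, fun {h Bh} hhB κ u => ?_⟩
  set G := coDressKBmAt (toSite (ctrOff (d + 1) Lc)) Lc (KInvStep (d := d) Lc j) with hGdef
  have hBh : 0 ≤ Bh := (abs_nonneg _).trans (hhB 0 0)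
  refine (Finset.abs_sum_le_sum_abs _ _).trans ?_
  have hterm : ∀ l, |∑' t : Site (d + 1), h l t * colH G Lc l t κ u| ≤ Bh * CH := by
    intro l
    have hs : Summable fun t : Site (d + 1) => |h l t * colH G Lc l t κ u| := by
      refine Summable.of_nonneg_of_le (fun _ => abs_nonneg _) (fun t => ?_) ((summable_abs_source_colH (Lc := Lc) j l κ u).mul_left Bh)
      rw [abs_mul]; exact mul_le_mul_of_nonneg_right (hhB l t) (abs_nonneg _)
    have h1 : |∑' t : Site (d + 1), h l t * colH G Lc l t κ u| ≤ ∑' t : Site (d + 1), |h l t * colH G Lc l t κ u| := by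
      have := norm_tsum_le_tsum_norm (f := fun t : Site (d + 1) => h l t * colH G Lc l t κ u) (by simpa only [Real.norm_eq_abs] using hs)
      simpa only [Real.norm_eq_abs] using this
    refine h1.trans ?_
    calc ∑' t : Site (d + 1), |h l t * colH G Lc l t κ u| ≤ ∑' t : Site (d + 1), Bh * |colH G Lc l t κ u| :=
          hs.tsum_le_tsum (fun t => by rw [abs_mul]; exact mul_le_mul_of_nonneg_right (hhB l t) (abs_nonneg _))
            ((summable_abs_source_colH (Lc := Lc) j l κ u).mul_left Bh)
      _ = Bh * ∑' t : Site (d + 1), |colH G Lc l t κ u| := tsum_mul_left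
      _ ≤ Bh * CH := mul_le_mul_of_nonneg_left (hCH l κ u) hBh
  calc ∑ l, |∑' t : Site (d + 1), h l t * colH G Lc l t κ u| ≤ ∑ _l : Fin (d + 1), Bh * CH := Finset.sum_le_sum fun l _ => hterm l
    _ = ((d : ℝ) + 1) * Bh * CH := by rw [Finset.sum_const, Finset.card_univ, Fintype.card_fin, nsmul_eq_mul]; push_cast; ring

/-- [folklore] **THE AVERAGING CONSTRAINT OF A FIELD RESPONSE** (centred root; `h` bounded): `𝒬_{Lc}(H_j h) κ Y = stepScale_j⁻¹·h κ Y`, `H_j h κ u = Σ_l Σ'_t h l t·colH G_j Lc l t κ u`. -/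
theorem contourSum_fieldResponse (j : ℕ) {h : Form1 (d + 1) ℝ} {Bh : ℝ} (hhB : ∀ l t, |h l t| ≤ Bh) (κ : Fin (d + 1)) (Y : Site (d + 1)) :
    contourSum Lc (fun κ u => ∑ l, ∑' t : Site (d + 1), h l t * colH (coDressKBmAt (toSite (ctrOff (d + 1) Lc)) Lc (KInvStep (d := d) Lc j)) Lc l t κ u) κ Y
      = (stepScale d Lc j)⁻¹ * h κ Y := by
  classical
  have hLc1 : 1 ≤ Lc := one_le_of_neZero Lc
  have hr := ctrOff_mem_box (d := d + 1) hLc1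
  set G := coDressKBmAt (toSite (ctrOff (d + 1) Lc)) Lc (KInvStep (d := d) Lc j) with hGdef
  -- summability of the source series at every field bond
  have hs : ∀ (l : Fin (d + 1)) (u : Site (d + 1)), Summable fun t : Site (d + 1) => h l t * colH G Lc l t κ u := fun l u => by
    refine Summable.of_norm_bounded ((summable_abs_source_colH (Lc := Lc) j l κ u).mul_left Bh) (fun t => ?_)
    rw [Real.norm_eq_abs, abs_mul]; exact mul_le_mul_of_nonneg_right (hhB l t) (abs_nonneg _)
  -- move the finite contour sums inside the source series
  have e1 : contourSum Lc (fun κ u => ∑ l, ∑' t : Site (d + 1), h l t * colH G Lc l t κ u) κ Y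
      = ∑ l, ∑' t : Site (d + 1), h l t * contourSum Lc (colH G Lc l t) κ Y := by
    simp only [AffineAveraging.contourSum]
    symm
    calc ∑ l, ∑' t : Site (d + 1), h l t * ∑ b ∈ box (d + 1) Lc, ∑ s ∈ Finset.range Lc, colH G Lc l t κ ((Lc : ℤ) • Y + toSite b + (s : ℤ) • unitVec κ)
        = ∑ l, ∑' t : Site (d + 1), ∑ b ∈ box (d + 1) Lc, ∑ s ∈ Finset.range Lc, h l t * colH G Lc l t κ ((Lc : ℤ) • Y + toSite b + (s : ℤ) • unitVec κ) := by
          refine Finset.sum_congr rfl fun l _ => tsum_congr fun t => ?_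
          rw [Finset.mul_sum]
          refine Finset.sum_congr rfl fun b _ => ?_
          rw [Finset.mul_sum]
      _ = ∑ l, ∑ b ∈ box (d + 1) Lc, ∑' t : Site (d + 1), ∑ s ∈ Finset.range Lc, h l t * colH G Lc l t κ ((Lc : ℤ) • Y + toSite b + (s : ℤ) • unitVec κ) := by
          refine Finset.sum_congr rfl fun l _ => ?_
          exact Summable.tsum_finsetSum (fun b _ => summable_sum fun s _ => hs l _)
      _ = ∑ l, ∑ b ∈ box (d + 1) Lc, ∑ s ∈ Finset.range Lc, ∑' t : Site (d + 1), h l t * colH G Lc l t κ ((Lc : ℤ) • Y + toSite b + (s : ℤ) • unitVec κ) := by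
          refine Finset.sum_congr rfl fun l _ => Finset.sum_congr rfl fun b _ => ?_
          exact Summable.tsum_finsetSum (fun s _ => hs l _)
      _ = ∑ b ∈ box (d + 1) Lc, ∑ s ∈ Finset.range Lc, ∑ l, ∑' t : Site (d + 1), h l t * colH G Lc l t κ ((Lc : ℤ) • Y + toSite b + (s : ℤ) • unitVec κ) := by
          rw [Finset.sum_comm]
          refine Finset.sum_congr rfl fun b _ => ?_
          rw [Finset.sum_comm]
  rw [e1]
  have e2 : ∀ l, (∑' t : Site (d + 1), h l t * contourSum Lc (colH G Lc l t) κ Y) = if κ = l then (stepScale d Lc j)⁻¹ * h l Y else 0 := by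
    intro l
    have ept : ∀ t, h l t * contourSum Lc (colH G Lc l t) κ Y = if t = Y then (if κ = l then (stepScale d Lc j)⁻¹ * h l Y else 0) else 0 := by
      intro t
      rw [hGdef, contourSum_colH_eq_ite hr j l t κ Y]
      by_cases ht : t = Y
      · subst ht
        by_cases hl : κ = l
        · rw [if_pos ⟨rfl, hl⟩, if_pos rfl, if_pos hl]; ring
        · rw [if_neg (fun h' => hl h'.2), if_pos rfl, if_neg hl, mul_zero]
      · rw [if_neg (fun h' => ht h'.1.symm), if_neg ht, mul_zero]
    rw [tsum_congr ept, tsum_eq_single Y (fun t ht => by rw [if_neg ht]), if_pos rfl]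
  simp only [e2, Finset.sum_ite_eq, Finset.mem_univ, if_true]

/-! ## §2 The Λ-slot weights of a field response in closed form -/

/-- NOT IN PRINT; OUR BOOKKEEPING.  **THE Λ-SLOT WEIGHTS OF A FIELD RESPONSE** (centred root `ρ = toSite (ctrOff (d+1) Lc)`, every level `j`, every BOUNDED `h`, every constraint slot `(μ, y)`):
`Σ'_u Σ_κ (H_j h)(κ,u)·lamCoeffK (KInvStep Lc j) (E2 j) Lc μ y κ u = −((Lc^j)^{d+2})⁻¹·stepScale_j⁻¹·Σ'_t Σ_l wΦ_{Lc^{j+1}} l μ (t − y)·h l t`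
— the tent (`lamCoeffK = −σ_j·𝒬ᵀ` of the translated multiplier column), adjointness onto `𝒬(H_j h)`, and the averaging constraint `𝒬(H_j h) = stepScale_j⁻¹·h`. -/
theorem tsum_fieldResponse_mul_lamCoeffK (j : ℕ) {h : Form1 (d + 1) ℝ} {Bh : ℝ} (hhB : ∀ l t, |h l t| ≤ Bh) (μ : Fin (d + 1)) (y : Site (d + 1)) :
    ∑' u : Site (d + 1), ∑ κ, (∑ l, ∑' t : Site (d + 1), h l t * colH (coDressKBmAt (toSite (ctrOff (d + 1) Lc)) Lc (KInvStep (d := d) Lc j)) Lc l t κ u)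
        * lamCoeffK (KInvStep (d := d) Lc j) (E2 d Lc j) Lc μ y κ u
      = -((((Lc ^ j : ℕ) : ℝ) ^ (d + 2))⁻¹ * ((stepScale d Lc j)⁻¹ * ∑' t : Site (d + 1), ∑ l, wΦ (N := Lc ^ (j + 1)) l μ (t - y) * h l t)) := by
  classical
  have hLc1 : 1 ≤ Lc := one_le_of_neZero Lc
  set G := coDressKBmAt (toSite (ctrOff (d + 1) Lc)) Lc (KInvStep (d := d) Lc j) with hGdef
  set Hh : Form1 (d + 1) ℝ := fun κ u => ∑ l, ∑' t : Site (d + 1), h l t * colH G Lc l t κ u with hHh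
  set σ : ℝ := (((Lc ^ j : ℕ) : ℝ) ^ (d + 2))⁻¹ with hσ
  set W : Form1 (d + 1) ℝ := fun κ' y' => wΦ (N := Lc ^ (j + 1)) κ' μ (y' - y) with hW
  show ∑' u : Site (d + 1), ∑ κ, Hh κ u * lamCoeffK (KInvStep (d := d) Lc j) (E2 d Lc j) Lc μ y κ u
      = -(σ * ((stepScale d Lc j)⁻¹ * ∑' t : Site (d + 1), ∑ l, wΦ (N := Lc ^ (j + 1)) l μ (t - y) * h l t))
  -- the tent
  have htent : ∀ κ u, lamCoeffK (KInvStep (d := d) Lc j) (E2 d Lc j) Lc μ y κ u = -(σ * contourSumAdj Lc W κ u) := fun κ u =>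
    lamCoeffK_KInvStep_E2_eq_neg_contourSumAdj (d := d) (Lc := Lc) j μ y κ u
  have e1 : (∑' u : Site (d + 1), ∑ κ, Hh κ u * lamCoeffK (KInvStep (d := d) Lc j) (E2 d Lc j) Lc μ y κ u)
      = -(σ * ∑' u : Site (d + 1), ∑ κ, Hh κ u * contourSumAdj Lc W κ u) := by
    rw [← tsum_mul_left, ← tsum_neg]
    refine tsum_congr fun u => ?_
    rw [Finset.mul_sum, ← Finset.sum_neg_distrib]
    refine Finset.sum_congr rfl fun κ _ => ?_
    rw [htent]; ring
  -- adjointness (the response is bounded, the translated multiplier column is summable through `quo`)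
  obtain ⟨CR, hCR0, hCR⟩ := abs_fieldResponse_le (d := d) (Lc := Lc) j
  have hm : ∀ κ u, |Hh κ u| ≤ ((d : ℝ) + 1) * Bh * CR := fun κ u => hCR hhB κ u
  have hφ : ∀ κ, Summable fun u : Site (d + 1) => |W κ (quo Lc u)| := fun κ => by
    have := summable_comp_quo' (d := d) hLc1 ((summable_wΦ_shift (N := Lc ^ (j + 1)) (d := d) μ y κ).abs)
    simpa only [hW] using this
  have e2 := tsum_mul_contourSumAdj_bdd (N := Lc) hm hφ
  rw [e1, e2]
  -- the averaging constraint
  have e3 : ∀ κ Y, contourSum Lc Hh κ Y = (stepScale d Lc j)⁻¹ * h κ Y := fun κ Y => by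
    rw [hHh, hGdef]; exact contourSum_fieldResponse (d := d) (Lc := Lc) j hhB κ Y
  congr 1
  congr 1
  rw [← tsum_mul_left]
  refine tsum_congr fun Y => ?_
  rw [Finset.mul_sum]
  refine Finset.sum_congr rfl fun κ _ => ?_
  rw [e3, hW]
  ring

/-! ## §3 The Λ-sector of the two-level pairing, slot sum outside, vanishes -/

/-- NOT IN PRINT; OUR BOOKKEEPING.  **THE Λ-SECTOR OF THE TWO-LEVEL PAIRING VANISHES, SLOT SUM OUTSIDE** (`Lc` odd, centred root, every `j`, every slot `(ν, y′)` of `G_{j+1}`, every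
bounded `Lc`-periodic `n`, every block label `y₀`): with `h = colH G_{j+1} Lc ν y′` (two-level) and the constraint-Hessian table `T(μ,y) = Σ'_u Σ_κ (H_j n)(κ,u)·(Σ'_x Σ_κ₂ hessFFAt ρ Lc μ y
u x (inl κ)(inl κ₂)·dz(1_{B(y₀)}∘blk∘blk) κ₂ x)` of (β) ∕ (δ2b) §3,
`Σ'_y Σ_μ T(μ,y)·(Σ'_u Σ_κ (H_j h)(κ,u)·lamCoeffK (KInvStep Lc j) (E2 j) Lc μ y κ u) = 0`
— §2 makes the weight `−σ_j·stepScale_j⁻¹·(C_j h)(μ,y)` (`wΦ_symm`), and (δ2b) §3 kills `Σ' (C_j h)·T`.  This is the Λ-sector `−Σ' (H_j h)·(SLam … κ u)[H_j n, d(ψ∘blk)]` of B″'s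
`X_{j+1}(n, 1_{B(y₀)}; ν, y′)` up to the weight `cΛ·wΛ_j` and up to moving the slot sum `Σ_μ Σ'_y` inside the leg sums (a Fubini step NOT taken here). -/
theorem lambdaSlotSum_twoLevel_eq_zero (hLc : Odd Lc) (j : ℕ) (ν : Fin (d + 1)) (y' : Site (d + 1)) {n : Form1 (d + 1) ℝ} {Bn : ℝ}
    (hnB : ∀ l t, |n l t| ≤ Bn) (hper : ∀ (l : Fin (d + 1)) (t z : Site (d + 1)), n l (t + (Lc : ℤ) • z) = n l t) (y₀ : Site (d + 1)) :
    ∑' y : Site (d + 1), ∑ μ,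
      (∑' u : Site (d + 1), ∑ κ,
          (∑ l, ∑' t : Site (d + 1), n l t * colH (coDressKBmAt (toSite (ctrOff (d + 1) Lc)) Lc (KInvStep (d := d) Lc j)) Lc l t κ u)
            * (∑' x : Site (d + 1), ∑ κ₂, hessFFAt (toSite (ctrOff (d + 1) Lc)) Lc μ y u x (Sum.inl κ) (Sum.inl κ₂)
                * dz (fun z => if blk Lc (blk Lc z) = y₀ then (1 : ℝ) else 0) κ₂ x))
      * (∑' u : Site (d + 1), ∑ κ,
          (∑ l, ∑' t : Site (d + 1), colH (coDressKBmAt (toSite (ctrOff (d + 1) Lc)) Lc (KInvStep (d := d) Lc (j + 1))) Lc ν y' l t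
              * colH (coDressKBmAt (toSite (ctrOff (d + 1) Lc)) Lc (KInvStep (d := d) Lc j)) Lc l t κ u)
            * lamCoeffK (KInvStep (d := d) Lc j) (E2 d Lc j) Lc μ y κ u) = 0 := by
  classical
  have hLc1 : 1 ≤ Lc := one_le_of_neZero Lc
  have hr := ctrOff_mem_box (d := d + 1) hLc1
  set G := coDressKBmAt (toSite (ctrOff (d + 1) Lc)) Lc (KInvStep (d := d) Lc j) with hGdef
  set G1 := coDressKBmAt (toSite (ctrOff (d + 1) Lc)) Lc (KInvStep (d := d) Lc (j + 1)) with hG1def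
  -- the two-level datum is bounded
  obtain ⟨δG, CG, hδG, hCG, hG1⟩ := decays_coDressKBmAt_KInvStep (d := d) hr (j + 1)
  have hhB : ∀ (l : Fin (d + 1)) (t : Site (d + 1)), |colH G1 Lc ν y' l t| ≤ CG := fun l t => by
    have h := hG1 t ((Lc : ℤ) • y') (Sum.inl l) (Sum.inr ν)
    refine h.trans (mul_le_of_le_one_right hCG ?_)
    rw [Real.exp_le_one_iff]
    have := l1_nonneg (t - (Lc : ℤ) • y')
    nlinarith
  have hmain := constraintHessianSector_twoLevel_eq_zero (d := d) hLc j ν y' hnB hper y₀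
  set T : Form1 (d + 1) ℝ := fun μ y => ∑' u : Site (d + 1), ∑ κ,
      (∑ l, ∑' t : Site (d + 1), n l t * colH G Lc l t κ u)
        * (∑' x : Site (d + 1), ∑ κ₂, hessFFAt (toSite (ctrOff (d + 1) Lc)) Lc μ y u x (Sum.inl κ) (Sum.inl κ₂)
            * dz (fun z => if blk Lc (blk Lc z) = y₀ then (1 : ℝ) else 0) κ₂ x) with hT
  set C : Form1 (d + 1) ℝ := fun μ w => ∑' v : Site (d + 1), ∑ l : Fin (d + 1), wΦ (N := Lc ^ (j + 1)) μ l (w - v) * colH G1 Lc ν y' l v with hC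
  replace hmain : ∑' w : Site (d + 1), ∑ μ, C μ w * T μ w = 0 := hmain
  set σ : ℝ := (((Lc ^ j : ℕ) : ℝ) ^ (d + 2))⁻¹ with hσ
  show ∑' y : Site (d + 1), ∑ μ, T μ y * (∑' u : Site (d + 1), ∑ κ,
      (∑ l, ∑' t : Site (d + 1), colH G1 Lc ν y' l t * colH G Lc l t κ u) * lamCoeffK (KInvStep (d := d) Lc j) (E2 d Lc j) Lc μ y κ u) = 0
  -- §2 at the two-level datum, rewritten through `wΦ_symm` into (δ2b)'s `C_j h`
  have hA : ∀ μ y, (∑' u : Site (d + 1), ∑ κ,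
      (∑ l, ∑' t : Site (d + 1), colH G1 Lc ν y' l t * colH G Lc l t κ u) * lamCoeffK (KInvStep (d := d) Lc j) (E2 d Lc j) Lc μ y κ u)
        = -(σ * (stepScale d Lc j)⁻¹) * C μ y := by
    intro μ y
    have h := tsum_fieldResponse_mul_lamCoeffK (d := d) (Lc := Lc) j (h := fun l t => colH G1 Lc ν y' l t) hhB μ y
    rw [← hGdef] at h
    rw [h, hC]
    have e : (∑' t : Site (d + 1), ∑ l, wΦ (N := Lc ^ (j + 1)) l μ (t - y) * colH G1 Lc ν y' l t)
        = ∑' v : Site (d + 1), ∑ l : Fin (d + 1), wΦ (N := Lc ^ (j + 1)) μ l (y - v) * colH G1 Lc ν y' l v :=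
      tsum_congr fun v => Finset.sum_congr rfl fun l _ => by rw [wΦ_symm, neg_sub]
    rw [e]; ring
  have e1 : (∑' y : Site (d + 1), ∑ μ, T μ y * (∑' u : Site (d + 1), ∑ κ,
      (∑ l, ∑' t : Site (d + 1), colH G1 Lc ν y' l t * colH G Lc l t κ u) * lamCoeffK (KInvStep (d := d) Lc j) (E2 d Lc j) Lc μ y κ u))
        = -(σ * (stepScale d Lc j)⁻¹) * ∑' y : Site (d + 1), ∑ μ, C μ y * T μ y := by
    rw [← tsum_mul_left]
    refine tsum_congr fun y => ?_
    rw [Finset.mul_sum]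
    refine Finset.sum_congr rfl fun μ _ => ?_
    rw [hA μ y]; ring
  rw [e1, hmain, mul_zero]

end Summit.QuantumFields.BalabanUV.Beta.GAN24.LambdaSlotWeightsTwoLevel

end
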